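import Mathlib
import Summits.Ventures.PercRepro2.Tail2DBlockCalc
import Summits.Ventures.PercRepro2.Tail2DHarrisSP
import Summits.Ventures.PercRepro2.Tail2DFlowOneBlocks
import Summits.Ventures.PercRepro2.Tail2DFlowOnePar
import Summits.Ventures.PercRepro2.Tail2DSDomSwap
import Summits.Ventures.PercRepro2.Tail2DFlowOneStep01
import Summits.Ventures.PercRepro2.Tail2DFlowOneThreeCounts
import Summits.Ventures.PercRepro2.Tail2DRelayBlocks

/-!
# Row-tails at every level, and the tails `E(u,0)`, `E(u−1,1)` of `X ∥ Y` for a flow-one `X`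
(seat mine-b, cell pub-perc-repro2; conjectures/MINE-B.md §45.8)

`rowTailAt Y i = {r ≥ i, b = 0}` with `E(i,0) = D(i,0) ⊔ E(i,1)`; on `X ∥ Y` with `X` flow-one,
`E(m+2,0) = R × E_Y(m+1,0) ⊔ col × E_Y(m+2,0)` and `E(m+1,1) = R × E_Y(m,1) ⊔ B × E_Y(m+1,0) ⊔ C × E_Y(m+1,1)`,
with their counts — the blocks of the relay step at `(u,0)` (`Tail2DRelayU0.lean`).
-/

namespace Summit.Ventures.PercRepro2.Tail2D

open V2Closure Finset

section BlocksU0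

variable (Y : V2Closure.SP)

/-- the row-tail `D(i,0) = {r ≥ i, b = 0}` at level `i` -/
def rowTailAt (i : ℕ) : Finset Y.Conf := Finset.univ.filter (fun y : Y.Conf => i ≤ Y.rLab y ∧ Y.bLab y = 0)

/-- membership in the row-tail at level `i` -/
theorem mem_rowTailAt (i : ℕ) (y : Y.Conf) : y ∈ rowTailAt Y i ↔ i ≤ Y.rLab y ∧ Y.bLab y = 0 := by
  simp [rowTailAt]

/-- `E(i,0) = D(i,0) ⊔ E(i,1)` -/
theorem card_rowTailAt_add (i : ℕ) : (rowTailAt Y i).card + tailCount Y i 1 = tailCount Y i 0 := by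
  rw [tailCount_eq_card, tailCount_eq_card, ← Finset.card_union_of_disjoint]
  · congr 1
    ext y
    simp only [Finset.mem_union, mem_rowTailAt, mem_tailSet_iff]
    omega
  · rw [Finset.disjoint_left]
    intro y h1 h2
    rw [mem_rowTailAt] at h1
    rw [mem_tailSet_iff] at h2
    omega

variable (X : V2Closure.SP)

/-- `E(m+2,0)` of `X ∥ Y` for flow-one `X`: `R × E_Y(m+1,0) ⊔ col × E_Y(m+2,0)` -/
theorem tailSet_par_u0_left (hX : FlowOne X) (m : ℕ) :
    tailSet (V2Closure.SP.par X Y) (m + 2) 0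
      = ((rSet X ×ˢ tailSet Y (m + 1) 0 : Finset (X.Conf × Y.Conf))
          ∪ (colSet X ×ˢ tailSet Y (m + 2) 0 : Finset (X.Conf × Y.Conf))) := by
  apply Finset.ext; intro p
  rw [mem_tailSet_par']
  refine Iff.trans ?_ Finset.mem_union.symm
  refine Iff.trans ?_ (or_congr Finset.mem_product Finset.mem_product).symm
  rw [mem_rSet, mem_colSet, mem_tailSet_iff, mem_tailSet_iff]
  have := hX p.1
  omega

/-- `#E(m+2,0) = a T_Y(m+1,0) + (n − a) T_Y(m+2,0)` -/
theorem tailCount_par_u0_left (hX : FlowOne X) (m : ℕ) :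
    tailCount (V2Closure.SP.par X Y) (m + 2) 0
      = (rSet X).card * tailCount Y (m + 1) 0 + (Fintype.card X.Conf - (rSet X).card) * tailCount Y (m + 2) 0 := by
  rw [tailCount_eq_card, tailSet_par_u0_left Y X hX m]
  show ((rSet X ×ˢ tailSet Y (m + 1) 0 : Finset (X.Conf × Y.Conf))
      ∪ (colSet X ×ˢ tailSet Y (m + 2) 0 : Finset (X.Conf × Y.Conf))).card = _
  rw [Finset.card_union_of_disjoint, Finset.card_product, Finset.card_product, card_colSet X hX,
    tailCount_eq_card, tailCount_eq_card]
  rw [Finset.disjoint_left]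
  intro p h1 h2
  rw [Finset.mem_product, mem_rSet] at h1
  rw [Finset.mem_product, mem_colSet] at h2
  omega

/-- `E(m+1,1)` of `X ∥ Y` for flow-one `X`: `R × E_Y(m,1) ⊔ B × E_Y(m+1,0) ⊔ C × E_Y(m+1,1)` -/
theorem tailSet_par_u1_left (hX : FlowOne X) (m : ℕ) :
    tailSet (V2Closure.SP.par X Y) (m + 1) 1
      = (((rSet X ×ˢ tailSet Y m 1 : Finset (X.Conf × Y.Conf))
          ∪ (bSet X ×ˢ tailSet Y (m + 1) 0 : Finset (X.Conf × Y.Conf)))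
          ∪ (cellSet X ×ˢ tailSet Y (m + 1) 1 : Finset (X.Conf × Y.Conf))) := by
  apply Finset.ext; intro p
  rw [mem_tailSet_par']
  refine Iff.trans ?_ Finset.mem_union.symm
  refine Iff.trans ?_ (or_congr Finset.mem_union Iff.rfl).symm
  refine Iff.trans ?_ (or_congr (or_congr Finset.mem_product Finset.mem_product) Finset.mem_product).symm
  rw [mem_rSet, mem_bSet, mem_cellSet, mem_tailSet_iff, mem_tailSet_iff, mem_tailSet_iff]
  have := hX p.1
  omega

/-- `#E(m+1,1) = a T_Y(m,1) + a T_Y(m+1,0) + c T_Y(m+1,1)` -/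
theorem tailCount_par_u1_left (hX : FlowOne X) (m : ℕ) :
    tailCount (V2Closure.SP.par X Y) (m + 1) 1
      = (rSet X).card * tailCount Y m 1 + (rSet X).card * tailCount Y (m + 1) 0
        + (cellSet X).card * tailCount Y (m + 1) 1 := by
  rw [tailCount_eq_card, tailSet_par_u1_left Y X hX m]
  show (((rSet X ×ˢ tailSet Y m 1 : Finset (X.Conf × Y.Conf))
      ∪ (bSet X ×ˢ tailSet Y (m + 1) 0 : Finset (X.Conf × Y.Conf)))
      ∪ (cellSet X ×ˢ tailSet Y (m + 1) 1 : Finset (X.Conf × Y.Conf))).card = _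
  rw [Finset.card_union_of_disjoint, Finset.card_union_of_disjoint, Finset.card_product, Finset.card_product,
    Finset.card_product, card_bSet_eq, tailCount_eq_card, tailCount_eq_card, tailCount_eq_card]
  · rw [Finset.disjoint_left]
    intro p h1 h2
    rw [Finset.mem_product, mem_rSet] at h1
    rw [Finset.mem_product, mem_bSet] at h2
    have := hX p.1
    omega
  · rw [Finset.disjoint_left]
    intro p h1 h2
    rw [Finset.mem_union, Finset.mem_product, Finset.mem_product, mem_rSet, mem_bSet] at h1
    rw [Finset.mem_product, mem_cellSet] at h2
    omega

end BlocksU0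

end Summit.Ventures.PercRepro2.Tail2D
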